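import Literature.Probability.RandomPlanarGeometry.StarHullExtension
import Literature.Probability.RandomPlanarGeometry.LoewnerSlidHullStar
import Literature.Probability.RandomPlanarGeometry.LoewnerRealKoebe
import Literature.Probability.RandomPlanarGeometry.LoewnerGrowth
import Literature.Probability.RandomPlanarGeometry.LoewnerAdaptedPlane
import Literature.Analysis.Complex.HydrodynamicCapacity
import Literature.Analysis.Complex.HalfPlaneRigidity
import HarnessLib

/-!
# One step of the conformal image of a Loewner chain: the map `φ = h' ∘ g ∘ h⁻¹` of a small hull

Deterministic core of [LSW] §5 / Lawler (2005) §4.6. Let `B ∈ 𝒬*` be a `*`-hull (the hull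
`A_s - W_s` seen from the tip at time `s`), `h = g_B` its hydrodynamically normalized map
(`hmap Φ = hullExt Φ - hullShift Φ`, `StarHullExtension`), and let `U` be a continuous driving
function with `U 0 = 0` (the increments `W(s + ·) - W(s)`) run for a short time `u`, with
Loewner map `g = g_u` and slid hull `B' = g(B) - U_u` (`Loewner.slidHull`). With
`h' (z) = g_{B'}(z - U_u) + U_u` the normalized map of `g(B)`, the composite

  `φ = h' ∘ g ∘ h⁻¹`

is the hydrodynamically normalized map of the SMALL hull `h(K_u)` near the real point
`w₀ = h(0) = -hullShift Φ` (Lawler (2005), §4.6.1: "`Φ_t = g*_{s,t} ∘ Φ_s ∘ g_{s,t}⁻¹`";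
[LSW] §5: `h_t = g̃_t ∘ g_A ∘ g_t⁻¹`). This file constructs `φ` — on the upper half-plane by the
formula (`phiPlus`), across the real axis by Schwarz reflection (`Literature.Analysis.Complex.schwarzExt`)
— and proves that it is `IsHydrodynamicAt φ w₀ r` (`Literature.Analysis.Complex.IsHydrodynamicAt`,
the hypothesis of the expansion `φ(w) = w + a/(w - w₀) + O(a r/|w - w₀|²)` of
`HydrodynamicExpansion` / `HydrodynamicCapacity`, Lawler's Prop. 3.46) with `r = 2η`,
`η = sup_{v ≤ u} |U_v| + 4√u` the size of the increment hull (Lawler's Lemma 4.13), together with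
the conjugation identity `φ(h z) = h'(g z)` off the small hull. The key analytic input for
`im φ ≤ im` is the boundary Julia lemma `Complex.im_le_im_of_tendsto_sub_self`
(`HalfPlaneRigidity`) applied to the inverse `ψ = h ∘ g⁻¹ ∘ h'⁻¹ : ℍ → ℍ`.

Main results (hypotheses: `B ∈ 𝒬*` with `B(0, 8ρ₀) ∩ B = ∅`, `Φ` a restriction map of `B`,
`U` continuous with `U 0 = 0`, `|U_v| ≤ S` on `[0, u]`, `0 < u`, and the smallness `η ≤ ρ₀`;
`Φ'` a restriction map of the slid hull):

* `isStarHull_slidHull_step` — `B' = slidHull U B u ∈ 𝒬*`, at distance `≥ 6ρ₀` from `0`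
  (`disjoint_ball_slidHull`); far points are alive and move little (`alive_of_stepSize_le`);
* `isHydrodynamicAt_phiStep` — **`φ` is `IsHydrodynamicAt` at `w₀ = -L` with radius `2η`**;
* `phiStep_hmap_of_im_pos`, `phiStep_hmap_of_im_neg`, `phiStep_hmap_of_real` — **the identity
  `φ(h(z)) = h'(g(z))`** above, below (symmetry) and on the axis (continuity), for `z` off `B`
  and (below / on the axis) alive with `|E_B(z)| > 2η`.

The quantitative consequences (the residue computation of `∂_t h_t` along the circle
`|z| = ρ₀`, Lawler's Prop. 4.40) are in a sequel.

## References

* G. F. Lawler, *Conformally Invariant Processes in the Plane* (2005), §4.6.1 (before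
  Prop. 4.40), Lemma 4.13 [Lawler2005].
* G. F. Lawler, O. Schramm, W. Werner, *Conformal restriction: the chordal case* (2003), §5
  [LawlerSchrammWerner2003Restriction].
-/

noncomputable section

open Set Filter Metric Bornology Function
open _root_.Complex _root_.Topology
open UpperHalfPlane (upperHalfPlaneSet isOpen_upperHalfPlaneSet)
open Literature.Analysis.Complex (schwarzExt IsHydrodynamicAt hcapAt)
open scoped ComplexConjugate NNReal

namespace Literature.Probability.RandomPlanarGeometry

namespace Loewner

/-! ### The hydrodynamic maps `h = g_B` and `h'` -/

/-- **The hydrodynamically normalized map `g_B = E_B - L`** of a hull (`E_B = hullExt Φ` the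
reflected restriction map, `L = hullShift Φ`): `g_B(z) - z → 0` at `∞`, and `g_B(0) = -L`.
[cite: LawlerSchrammWerner2003Restriction, §2 pp. 7–8 (g_A, Φ_A = g_A − g_A(0))] -/
def hmap {B : Set ℂ} (Φ : ConformalEquiv (upperHalfPlaneSet \ B) upperHalfPlaneSet) (z : ℂ) : ℂ :=
  hullExt Φ z - hullShift Φ

/-- **The normalized map of the translated hull `B' + c`**: `z ↦ g_{B'}(z - c) + c` (for the
un-slid hull `g_u(B) = B' + U_u`; [LSW] §5: `h_t = g_{A_t}`, `A_t = g_t(A)`).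
[cite: LawlerSchrammWerner2003Restriction, §5 (A_t = g_t(A), h_t = g_{A_t})] -/
def hmapT {B' : Set ℂ} (Φ' : ConformalEquiv (upperHalfPlaneSet \ B') upperHalfPlaneSet) (c : ℝ)
    (z : ℂ) : ℂ :=
  hullExt Φ' (z - c) - hullShift Φ' + c

section Step

variable {B : Set ℂ} {Φ : ConformalEquiv (upperHalfPlaneSet \ B) upperHalfPlaneSet}
  {U : ℝ≥0 → ℝ} {u : ℝ≥0} {S ρ₀ : ℝ}
  {Φ' : ConformalEquiv (upperHalfPlaneSet \ slidHull U B u) upperHalfPlaneSet}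

/-- The size `η = S + 4√u` of the increment hull (Lawler's Lemma 4.13: `rad K_u ≤ 4 max{√u, S}`).
[cite: Lawler2005, Lemma 4.13] -/
def stepSize (S : ℝ) (u : ℝ≥0) : ℝ := S + 4 * Real.sqrt u

variable (hB : IsStarHull B) (hΦ : IsRestrictionMap B Φ) (hU : Continuous U) (hU0 : U 0 = 0)
  (hu : 0 < u) (hS : ∀ v : ℝ≥0, v ≤ u → |U v| ≤ S) (hρ₀ : 0 < ρ₀)
  (hBρ : Disjoint (ball (0 : ℂ) (8 * ρ₀)) B) (hη : stepSize S u ≤ ρ₀)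

/-! ### Geometry of one step: far points are alive, the increment hull is small -/

include hu hS in
/-- `S ≥ 0` and `η > 0`. [folklore] -/
theorem stepSize_pos : 0 ≤ S ∧ 0 < stepSize S u := by
  have hS0 : 0 ≤ S := (abs_nonneg _).trans (hS 0 bot_le)
  exact ⟨hS0, by rw [stepSize]; have := Real.sqrt_pos.2 (NNReal.coe_pos.2 hu); positivity⟩

include hU hu hS in
/-- **Points at distance `≥ η` from `0` are alive at time `u`, stay `2√u` away from the driver
and move by at most `v/√u` up to time `v ≤ u`** (`LoewnerGrowth.lt_swallowingTime_of_far`).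
[cite: Lawler2005, Lemma 4.13] -/
theorem alive_of_stepSize_le {z : ℂ} (hz : stepSize S u ≤ ‖z‖) :
    (u : WithTop ℝ≥0) < swallowingTime U z ∧
      ∀ v : ℝ≥0, v ≤ u → 2 * Real.sqrt u ≤ ‖map U v z - U v‖ ∧
        ‖map U v z - z‖ ≤ 2 / (2 * Real.sqrt u) * v := by
  have hsq : 0 < Real.sqrt u := Real.sqrt_pos.2 (NNReal.coe_pos.2 hu)
  have hM : ∀ v ∈ Icc (0 : ℝ) u, ‖((U v.toNNReal : ℝ) : ℂ) - 0‖ ≤ S := by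
    intro v hv
    rw [sub_zero, norm_real, Real.norm_eq_abs]
    exact hS _ (by
      rw [← NNReal.coe_le_coe, Real.coe_toNNReal v hv.1]; exact hv.2)
  have hδt : 4 * (u : ℝ) ≤ (2 * Real.sqrt u) ^ 2 := by
    rw [mul_pow, Real.sq_sqrt u.coe_nonneg]; linarith
  have hfar : S + 2 * (2 * Real.sqrt u) ≤ ‖z - 0‖ := by
    rw [sub_zero]; rw [stepSize] at hz; linarith
  exact lt_swallowingTime_of_far hU hM (by positivity) hδt hfar

include hU hU0 hS in
/-- **Swallowed points are within `η` of `0`** (`norm_sub_driving_le_of_swallowingTime_le`).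
[cite: Lawler2005, Lemma 4.13] -/
theorem norm_le_stepSize_of_swallowingTime_le {z : ℂ} (hz : swallowingTime U z ≤ u) :
    ‖z‖ ≤ stepSize S u := by
  by_cases hz0 : z = 0
  · rw [hz0, norm_zero, stepSize]
    have hS0 : 0 ≤ S := (abs_nonneg _).trans (hS 0 bot_le)
    positivity
  have hS' : ∀ s : ℝ≥0, s ≤ u → |U s - U 0| ≤ S := fun s hs ↦ by rw [hU0, sub_zero]; exact hS s hs
  have h := norm_sub_driving_le_of_swallowingTime_le hU hS' (by rwa [hU0, ofReal_zero]) hz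
  rwa [hU0, ofReal_zero, sub_zero] at h

include hU hU0 hS hρ₀ hBρ hη in
/-- **The increment hull misses `B`**: `closedHull U u ∩ B = ∅`. [folklore] -/
theorem disjoint_closedHull : Disjoint (closedHull U u) B := by
  refine Set.disjoint_left.2 fun z hz hzB ↦ ?_
  have h1 := norm_le_stepSize_of_swallowingTime_le hU hU0 hS hz.2
  refine Set.disjoint_left.1 hBρ ?_ hzB
  rw [mem_ball_zero_iff]
  linarith

include hB hU hU0 hS hρ₀ hBρ hη in
/-- **The slid hull `B' = g_u(B) - U_u` is a `*`-hull.** [cite: LawlerSchrammWerner2003Restriction, §5 (A_t = g_t(A) ∈ 𝒬*, t < T)] -/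
theorem isStarHull_slidHull_step : IsStarHull (slidHull U B u) :=
  isStarHull_slidHull_of_disjoint hU hB (disjoint_closedHull hU hU0 hS hρ₀ hBρ hη)

include hBρ in
/-- Points of `B` are at distance `≥ 8ρ₀` from `0`. [folklore] -/
theorem le_norm_of_mem {b : ℂ} (hb : b ∈ B) : 8 * ρ₀ ≤ ‖b‖ := by
  by_contra h
  push Not at h
  exact Set.disjoint_left.1 hBρ (mem_ball_zero_iff.2 h) hb

include hU hu hS hBρ hη in
/-- **Points of `B` are alive and move by at most `√u ≤ η/4`.** [cite: Lawler2005, Lemma 4.13] -/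
theorem alive_of_mem {b : ℂ} (hb : b ∈ B) :
    (u : WithTop ℝ≥0) < swallowingTime U b ∧ ‖map U u b - b‖ ≤ Real.sqrt u := by
  have hη0 := (stepSize_pos hu hS).2
  have hb8 := le_norm_of_mem hBρ hb
  obtain ⟨halive, hmove⟩ := alive_of_stepSize_le hU hu hS (z := b) (by linarith)
  refine ⟨halive, ?_⟩
  have h := (hmove u le_rfl).2
  have hsq : 0 < Real.sqrt u := Real.sqrt_pos.2 (NNReal.coe_pos.2 hu)
  calc ‖map U u b - b‖ ≤ 2 / (2 * Real.sqrt u) * u := h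
    _ = Real.sqrt u := by
        have : (u : ℝ) = Real.sqrt u * Real.sqrt u := (Real.mul_self_sqrt u.coe_nonneg).symm
        field_simp
        linarith [this]

include hU hu hS hBρ hη in
/-- **The slid hull stays far from `0`**: `B(0, 6ρ₀) ∩ B' = ∅`. [folklore] -/
theorem disjoint_ball_slidHull : Disjoint (ball (0 : ℂ) (2 * (3 * ρ₀))) (slidHull U B u) := by
  refine Set.disjoint_left.2 fun w hw hwB ↦ ?_
  obtain ⟨b, hb, rfl⟩ := hwB
  have hb8 := le_norm_of_mem hBρ hb
  have hmove := (alive_of_mem hU hu hS hBρ hη hb).2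
  have hUu : |U u| ≤ S := hS u le_rfl
  have hη' : S + 4 * Real.sqrt u ≤ ρ₀ := hη
  have hsq : 0 ≤ Real.sqrt u := Real.sqrt_nonneg _
  have hw' : ‖map U u b - U u‖ < 2 * (3 * ρ₀) := mem_ball_zero_iff.1 hw
  have : ‖b‖ ≤ ‖map U u b - U u‖ + ‖map U u b - b‖ + ‖((U u : ℝ) : ℂ)‖ := by
    calc ‖b‖ = ‖(map U u b - U u) - (map U u b - b) + (U u : ℂ)‖ := by ring_nf
      _ ≤ ‖(map U u b - U u) - (map U u b - b)‖ + ‖((U u : ℝ) : ℂ)‖ := norm_add_le _ _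
      _ ≤ ‖map U u b - U u‖ + ‖map U u b - b‖ + ‖((U u : ℝ) : ℂ)‖ := by
          linarith [norm_sub_le (map U u b - U u) (map U u b - b)]
  rw [norm_real, Real.norm_eq_abs] at this
  have h4 : 4 * Real.sqrt u ≤ ρ₀ - S := by linarith
  linarith [abs_nonneg (U u)]

/-! ### The map `φ⁺ = h' ∘ g ∘ h⁻¹` on the upper half-plane -/

/-- **`φ⁺(w) = h'(g(h⁻¹(w)))`** for `w ∈ ℍ`: `h⁻¹(w) = Φ_B⁻¹(w + L)` there. [cite: Lawler2005, §4.6.1 (Φ_t = g*_{s,t} ∘ Φ_s ∘ g_{s,t}⁻¹)] -/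
def phiPlus (Φ : ConformalEquiv (upperHalfPlaneSet \ B) upperHalfPlaneSet)
    (Φ' : ConformalEquiv (upperHalfPlaneSet \ slidHull U B u) upperHalfPlaneSet) (w : ℂ) : ℂ :=
  hmapT Φ' (U u) (map U u (Φ.symm (w + hullShift Φ)))

/-- **The exterior domain** `{w : r < |w - w₀|}` of the small hull, `w₀ = -L = h(0)`. [folklore] -/
def stepDomain (Φ : ConformalEquiv (upperHalfPlaneSet \ B) upperHalfPlaneSet) (r : ℝ) : Set ℂ :=
  {w | r < ‖w - (-hullShift Φ)‖}

/-- **`φ = h' ∘ g ∘ h⁻¹` reflected across the real axis** outside `B(w₀, r)`. [cite: Lawler2005, §4.6.1 (Φ_t = g*_{s,t} ∘ Φ_s ∘ g_{s,t}⁻¹)] -/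
def phiStep (Φ : ConformalEquiv (upperHalfPlaneSet \ B) upperHalfPlaneSet)
    (Φ' : ConformalEquiv (upperHalfPlaneSet \ slidHull U B u) upperHalfPlaneSet) (r : ℝ) : ℂ → ℂ :=
  schwarzExt (stepDomain Φ r) (phiPlus Φ Φ')

variable (hΦ' : IsRestrictionMap (slidHull U B u) Φ')

include hB hΦ in
/-- `w + L ∈ ℍ` for `w ∈ ℍ` (`L` is real). [folklore] -/
theorem add_hullShift_mem {w : ℂ} (hw : 0 < w.im) : w + hullShift Φ ∈ upperHalfPlaneSet := by
  show 0 < (w + hullShift Φ).im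
  rw [add_im, hullShift_im hB.isBoundedHull hΦ, add_zero]; exact hw

include hB hΦ in
/-- For `w ∈ ℍ`, `z = Φ_B⁻¹(w + L)` lies in `ℍ ∖ B` with `E_B(z) = w + L = w - w₀`. [folklore] -/
theorem symm_add_hullShift_spec {w : ℂ} (hw : 0 < w.im) :
    Φ.symm (w + hullShift Φ) ∈ upperHalfPlaneSet \ B ∧
      hullExt Φ (Φ.symm (w + hullShift Φ)) = w - (-hullShift Φ) := by
  have hmem := Φ.symm_mapsTo (add_hullShift_mem hB hΦ hw)
  refine ⟨hmem, ?_⟩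
  rw [hullExt_of_mem_diff hmem, Φ.apply_symm_apply (add_hullShift_mem hB hΦ hw)]
  ring

include hB hΦ hu hS hρ₀ hBρ hη in
/-- **Points of the exterior domain pull back to points outside `B̄(0, η)`**: if `w ∈ ℍ` with
`|w - w₀| > 2η` then `z = Φ_B⁻¹(w + L)` has `|z| > η` (since `E_B` is `2`-Lipschitz on
`B(0, 4ρ₀)` with `E_B(0) = 0`). [folklore] -/
theorem stepSize_lt_norm_symm {w : ℂ} (hw : 0 < w.im) (hwr : 2 * stepSize S u < ‖w - (-hullShift Φ)‖) :
    stepSize S u < ‖Φ.symm (w + hullShift Φ)‖ := by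
  obtain ⟨hz, hEz⟩ := symm_add_hullShift_spec hB hΦ hw
  set z := Φ.symm (w + hullShift Φ) with hzdef
  by_contra hle
  push Not at hle
  have hη0 := (stepSize_pos hu hS).2
  have hL : LipschitzOnWith 2 (hullExt Φ) (ball ((0 : ℝ) : ℂ) (8 * ρ₀ / 2)) :=
    lipschitzOnWith_hullExt hB.isBoundedHull hΦ (by simpa using hBρ)
  have hz4 : z ∈ ball ((0 : ℝ) : ℂ) (8 * ρ₀ / 2) := by
    rw [ofReal_zero, mem_ball_zero_iff]; linarith
  have h04 : (0 : ℂ) ∈ ball ((0 : ℝ) : ℂ) (8 * ρ₀ / 2) := by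
    rw [ofReal_zero]; exact mem_ball_self (by positivity)
  have h := hL.dist_le_mul z hz4 0 h04
  rw [hullExt_zero hB hΦ, dist_zero_right, dist_zero_right, hEz] at h
  have : ‖w - (-hullShift Φ)‖ ≤ 2 * stepSize S u := h.trans (by push_cast; linarith)
  linarith

include hB hΦ hU hu hS hρ₀ hBρ hη in
/-- For `w ∈ ℍ ∩ {|w - w₀| > 2η}`: the pulled-back point `z` is alive, `g(z) ∈ ℍ` and
`g(z) - U_u ∈ ℍ ∖ B'`. [folklore] -/
theorem map_symm_spec {w : ℂ} (hw : 0 < w.im) (hwr : 2 * stepSize S u < ‖w - (-hullShift Φ)‖) :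
    (u : WithTop ℝ≥0) < swallowingTime U (Φ.symm (w + hullShift Φ)) ∧
      map U u (Φ.symm (w + hullShift Φ)) - U u ∈ upperHalfPlaneSet \ slidHull U B u := by
  obtain ⟨hz, -⟩ := symm_add_hullShift_spec hB hΦ hw
  set z := Φ.symm (w + hullShift Φ) with hzdef
  have hzη := stepSize_lt_norm_symm hB hΦ hu hS hρ₀ hBρ hη hw hwr
  obtain ⟨halive, hmove⟩ := alive_of_stepSize_le hU hu hS hzη.le
  refine ⟨halive, ⟨?_, ?_⟩⟩
  · show 0 < (map U u z - U u).im
    rw [sub_im, ofReal_im, sub_zero]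
    exact mapsTo_map hU u ((mem_domain_iff U u z).2 ⟨hz.1, halive⟩)
  · rintro ⟨b, hb, hbeq⟩
    have hbalive := (alive_of_mem hU hu hS hBρ hη hb).1
    have heq : map U u b = map U u z := by
      have := congrArg (· + (U u : ℂ)) hbeq
      simpa using this
    have hbz := injOn_map_of_lt_swallowingTime hU u hbalive halive heq
    rw [hbz] at hb
    exact hz.2 hb

include hB hΦ hU hU0 hu hS hρ₀ hBρ hη hΦ' in
/-- **`φ⁺` is holomorphic on `ℍ ∩ {|w - w₀| > 2η}`.** [folklore] -/
theorem differentiableOn_phiPlus :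
    DifferentiableOn ℂ (phiPlus Φ Φ') (stepDomain Φ (2 * stepSize S u) ∩ {w | 0 < w.im}) := by
  have hB' := isStarHull_slidHull_step hB hU hU0 hS hρ₀ hBρ hη
  intro w ⟨hwr, hw⟩
  have hwr' : 2 * stepSize S u < ‖w - (-hullShift Φ)‖ := hwr
  obtain ⟨halive, hζ⟩ := map_symm_spec hB hΦ hU hu hS hρ₀ hBρ hη hw hwr'
  have hwL := add_hullShift_mem hB hΦ hw
  -- the four factors
  have h1 : DifferentiableAt ℂ (fun w : ℂ ↦ w + hullShift Φ) w := differentiableAt_id.add_const _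
  have h2 : DifferentiableAt ℂ Φ.symm (w + hullShift Φ) :=
    Φ.symm.differentiableOn_coe.differentiableAt (isOpen_upperHalfPlaneSet.mem_nhds hwL)
  have h3 : DifferentiableAt ℂ (map U u) (Φ.symm (w + hullShift Φ)) :=
    (differentiableOn_map_of_lt_swallowingTime hU u).differentiableAt
      ((isOpen_setOf_lt_swallowingTime hU u).mem_nhds halive)
  set p : ℂ := map U u (Φ.symm (w + hullShift Φ)) with hp
  have h4 : DifferentiableAt ℂ (hmapT Φ' (U u)) p := by
    have h41 : DifferentiableAt ℂ (hullExt Φ') (p - U u) :=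
      differentiableAt_hullExt hB'.isBoundedHull hΦ' (hB'.isBoundedHull.mem_symmDomain_of_mem_diff hζ)
    have h42 : DifferentiableAt ℂ (fun z : ℂ ↦ z - (U u : ℂ)) p := differentiableAt_id.sub_const _
    have h43 : DifferentiableAt ℂ (fun z : ℂ ↦ hullExt Φ' (z - U u)) p := h41.comp p h42
    show DifferentiableAt ℂ (fun z : ℂ ↦ hullExt Φ' (z - U u) - hullShift Φ' + U u) p
    exact (h43.sub_const _).add_const _
  exact (h4.comp w (h3.comp w (h2.comp w h1))).differentiableWithinAt

include hB hΦ hU hU0 hu hS hρ₀ hBρ hη hΦ' in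
/-- **`im φ⁺ > 0` on `ℍ ∩ {|w - w₀| > 2η}`.** [folklore] -/
theorem phiPlus_im_pos {w : ℂ} (hw : 0 < w.im) (hwr : 2 * stepSize S u < ‖w - (-hullShift Φ)‖) :
    0 < (phiPlus Φ Φ' w).im := by
  have hB' := isStarHull_slidHull_step hB hU hU0 hS hρ₀ hBρ hη
  obtain ⟨-, hζ⟩ := map_symm_spec hB hΦ hU hu hS hρ₀ hBρ hη hw hwr
  rw [phiPlus, hmapT, add_im, ofReal_im, add_zero, sub_im, hullShift_im hB'.isBoundedHull hΦ', sub_zero]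
  exact hullExt_im_pos hζ


/-! ### The inverse `ψ = h ∘ g⁻¹ ∘ h'⁻¹ : ℍ → ℍ` and `im φ⁺ ≤ im` -/

/-- **The inverse composite `ψ(ζ) = h(g_u⁻¹(h'⁻¹(ζ)))`** on `ℍ`
(`h'⁻¹(ζ) = Φ_{B'}⁻¹(ζ - U_u + L') + U_u`, `g_u⁻¹ = loewnerInv`). [folklore] -/
def psiStep (Φ : ConformalEquiv (upperHalfPlaneSet \ B) upperHalfPlaneSet)
    (Φ' : ConformalEquiv (upperHalfPlaneSet \ slidHull U B u) upperHalfPlaneSet) (ζ : ℂ) : ℂ :=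
  hmap Φ (loewnerInv U u (Φ'.symm (ζ - U u + hullShift Φ') + U u))

/-- A map asymptotic to the identity within `ℍ` tends to `∞` within `ℍ` if it preserves `ℍ`.
[folklore] -/
theorem tendsto_cocompact_inf_of_sub_tendsto {f : ℂ → ℂ} {c : ℂ}
    (hf : Tendsto (fun z ↦ f z - z) (cocompact ℂ ⊓ 𝓟 upperHalfPlaneSet) (𝓝 c))
    (hmaps : MapsTo f upperHalfPlaneSet upperHalfPlaneSet) :
    Tendsto f (cocompact ℂ ⊓ 𝓟 upperHalfPlaneSet) (cocompact ℂ ⊓ 𝓟 upperHalfPlaneSet) := by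
  refine tendsto_inf.2 ⟨?_, tendsto_principal.2 ?_⟩
  · rw [← cobounded_eq_cocompact, ← tendsto_norm_atTop_iff_cobounded]
    -- `‖f z‖ ≥ ‖z‖ - ‖f z - z‖` and `‖f z - z‖` is eventually bounded
    have hb : ∀ᶠ z in cobounded ℂ ⊓ 𝓟 upperHalfPlaneSet, ‖f z - z‖ ≤ ‖c‖ + 1 := by
      have := hf (closedBall_mem_nhds c one_pos)
      rw [cobounded_eq_cocompact]
      filter_upwards [this] with z hz
      have hz' : f z - z ∈ closedBall c 1 := hz
      rw [mem_closedBall, dist_eq_norm] at hz'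
      linarith [norm_sub_norm_le (f z - z) c]
    have hn : Tendsto (fun z : ℂ ↦ ‖z‖ + (-(‖c‖ + 1))) (cobounded ℂ ⊓ 𝓟 upperHalfPlaneSet) atTop :=
      tendsto_atTop_add_const_right _ _ (tendsto_norm_cobounded_atTop.mono_left inf_le_left)
    refine tendsto_atTop_mono' _ ?_ hn
    filter_upwards [hb] with z hz
    linarith [norm_sub_norm_le z (f z), norm_sub_rev (f z) z]
  · filter_upwards [mem_inf_of_right (mem_principal_self _)] with z hz using hmaps hz

include hB hΦ hU hU0 hS hρ₀ hBρ hη hΦ' in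
/-- **`ψ` maps `ℍ` into `ℍ`, through the points `h'⁻¹(ζ) - U_u ∈ ℍ ∖ B'`, `g⁻¹(h'⁻¹ ζ) ∈ ℍ ∖ B`.**
[folklore] -/
theorem psiStep_spec {ζ : ℂ} (hζ : 0 < ζ.im) :
    Φ'.symm (ζ - U u + hullShift Φ') ∈ upperHalfPlaneSet \ slidHull U B u ∧
      loewnerInv U u (Φ'.symm (ζ - U u + hullShift Φ') + U u) ∈ upperHalfPlaneSet \ B ∧
      0 < (psiStep Φ Φ' ζ).im := by
  have hB' := isStarHull_slidHull_step hB hU hU0 hS hρ₀ hBρ hη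
  have hζ' : ζ - U u + hullShift Φ' ∈ upperHalfPlaneSet := by
    show 0 < (ζ - U u + hullShift Φ').im
    rw [add_im, sub_im, ofReal_im, hullShift_im hB'.isBoundedHull hΦ']; simpa using hζ
  have hy' := Φ'.symm_mapsTo hζ'
  set y' := Φ'.symm (ζ - U u + hullShift Φ') with hy'def
  have hyim : 0 < (y' + U u).im := by
    rw [add_im, ofReal_im, add_zero]; exact hy'.1
  have hx := loewnerInv_mem_domain hU u hyim
  set x := loewnerInv U u (y' + U u) with hxdef
  have hxH : x ∈ upperHalfPlaneSet := ((mem_domain_iff U u x).1 hx).1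
  have hxB : x ∉ B := by
    intro hxB
    -- then `g x - U u = y' ∈ B'`
    have : y' ∈ slidHull U B u := ⟨x, hxB, by
      show map U u (loewnerInv U u (y' + U u)) - U u = y'
      rw [map_loewnerInv hU u hyim]; ring⟩
    exact hy'.2 this
  refine ⟨hy', ⟨hxH, hxB⟩, ?_⟩
  rw [psiStep, hmap, sub_im, hullShift_im hB.isBoundedHull hΦ, sub_zero]
  exact hullExt_im_pos (Φ := Φ) ⟨hxH, hxB⟩

include hB hΦ hU hU0 hS hρ₀ hBρ hη hΦ' in
/-- **`ψ` is holomorphic on `ℍ`.** [folklore] -/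
theorem differentiableOn_psiStep : DifferentiableOn ℂ (psiStep Φ Φ') upperHalfPlaneSet := by
  have hB' := isStarHull_slidHull_step hB hU hU0 hS hρ₀ hBρ hη
  intro ζ hζ
  obtain ⟨hy', hx, -⟩ := psiStep_spec hB hΦ hU hU0 hS hρ₀ hBρ hη hΦ' (ζ := ζ) hζ
  have hζ' : ζ - U u + hullShift Φ' ∈ upperHalfPlaneSet := by
    show 0 < (ζ - U u + hullShift Φ').im
    rw [add_im, sub_im, ofReal_im, hullShift_im hB'.isBoundedHull hΦ']; simpa using hζ
  have hyim : 0 < (Φ'.symm (ζ - U u + hullShift Φ') + U u).im := by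
    rw [add_im, ofReal_im, add_zero]; exact hy'.1
  have h1 : DifferentiableAt ℂ (fun ζ : ℂ ↦ ζ - U u + hullShift Φ') ζ :=
    (differentiableAt_id.sub_const _).add_const _
  have h2 : DifferentiableAt ℂ Φ'.symm (ζ - U u + hullShift Φ') :=
    Φ'.symm.differentiableOn_coe.differentiableAt (isOpen_upperHalfPlaneSet.mem_nhds hζ')
  have h3 : DifferentiableAt ℂ (fun y : ℂ ↦ Φ'.symm (y) + U u) (ζ - U u + hullShift Φ') := h2.add_const _
  have h4 : DifferentiableAt ℂ (loewnerInv U u) (Φ'.symm (ζ - U u + hullShift Φ') + U u) :=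
    (differentiableOn_invFunOn_map hU u).differentiableAt (isOpen_upperHalfPlaneSet.mem_nhds hyim)
  have h5 : DifferentiableAt ℂ (hmap Φ) (loewnerInv U u (Φ'.symm (ζ - U u + hullShift Φ') + U u)) := by
    have := differentiableAt_hullExt hB.isBoundedHull hΦ (hB.isBoundedHull.mem_symmDomain_of_mem_diff hx)
    exact this.sub_const _
  exact (h5.comp ζ (h4.comp ζ (h3.comp ζ h1))).differentiableWithinAt

include hB hΦ hU hU0 hS hρ₀ hBρ hη hΦ' in
/-- **`ψ(ζ) - ζ → 0` as `ζ → ∞` in `ℍ`**: the three factors are asymptotic to the identity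
(`Φ_{B'}⁻¹(ζ') - ζ' → -L'`, `g⁻¹(y) - y → 0`, `h(x) - x → 0`). [folklore] -/
theorem tendsto_psiStep_sub_self :
    Tendsto (fun ζ ↦ psiStep Φ Φ' ζ - ζ) (cocompact ℂ ⊓ 𝓟 upperHalfPlaneSet) (𝓝 0) := by
  have hB' := isStarHull_slidHull_step hB hU hU0 hS hρ₀ hBρ hη
  set F := cocompact ℂ ⊓ 𝓟 upperHalfPlaneSet with hF
  -- stage 1: `ζ ↦ ζ' = ζ - U u + L'`
  set s1 : ℂ → ℂ := fun ζ ↦ ζ - U u + hullShift Φ' with hs1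
  have hL'real : hullShift Φ' = ((hullShift Φ').re : ℂ) :=
    Complex.ext rfl (by rw [ofReal_im]; exact hullShift_im hB'.isBoundedHull hΦ')
  have hT1 : Tendsto s1 F F := by
    have := tendsto_add_real_cocompact_inf ((hullShift Φ').re - U u)
    refine this.congr fun ζ ↦ ?_
    rw [hs1]; nth_rewrite 2 [hL'real]; push_cast; ring
  -- stage 2: `ζ' ↦ y = Φ'.symm ζ' + U u`, with `y - ζ' → -L' + U u`
  set s2 : ℂ → ℂ := fun ζ' ↦ Φ'.symm ζ' + U u with hs2
  have hT2sub : Tendsto (fun ζ' ↦ s2 ζ' - ζ') F (𝓝 (-hullShift Φ' + U u)) := by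
    have := (hΦ'.tendsto_symm_sub_self hB').add (tendsto_const_nhds (x := ((U u : ℝ) : ℂ)))
    refine this.congr fun ζ' ↦ ?_
    rw [hs2]; ring
  have hT2 : Tendsto s2 F F :=
    tendsto_cocompact_inf_of_sub_tendsto hT2sub fun ζ' hζ' ↦ by
      show 0 < (Φ'.symm ζ' + U u).im
      rw [add_im, ofReal_im, add_zero]; exact (Φ'.symm_mapsTo hζ').1
  -- stage 3: `y ↦ x = g⁻¹ y`, `x - y → 0`
  have hT3sub : Tendsto (fun y ↦ loewnerInv U u y - y) F (𝓝 0) := tendsto_invFunOn_map_sub_self hU u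
  have hT3 : Tendsto (loewnerInv U u) F F :=
    tendsto_cocompact_inf_of_sub_tendsto hT3sub fun y hy ↦
      ((mem_domain_iff U u _).1 (loewnerInv_mem_domain hU u hy)).1
  -- stage 4: `x ↦ h x`, `h x - x → 0`
  have hT4sub : Tendsto (fun x ↦ hmap Φ x - x) F (𝓝 0) := by
    have h0 : Tendsto (fun x ↦ hullExt Φ x - x) F (𝓝 (hullShift Φ)) :=
      (tendsto_hullExt_sub_self hB.isBoundedHull hΦ).mono_left inf_le_left
    have := h0.sub (tendsto_const_nhds (x := hullShift Φ))
    rw [sub_self] at this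
    refine this.congr fun x ↦ ?_
    simp only [hmap]; ring
  -- combine: `ψ ζ - ζ = (h x - x) + (x - y) + (y - ζ') + (ζ' - ζ)`
  have e4 := hT4sub.comp (hT3.comp (hT2.comp hT1))
  have e3 := hT3sub.comp (hT2.comp hT1)
  have e2 := hT2sub.comp hT1
  have hsum := (e4.add e3).add e2
  have hlim : (0 : ℂ) + 0 + (-hullShift Φ' + U u) = -hullShift Φ' + U u := by ring
  rw [hlim] at hsum
  have hfinal := hsum.add (tendsto_const_nhds (x := hullShift Φ' - U u))
  rw [show -hullShift Φ' + (U u : ℂ) + (hullShift Φ' - U u) = 0 by ring] at hfinal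
  refine hfinal.congr fun ζ ↦ ?_
  simp only [comp_apply, psiStep, hs1, hs2]
  ring

include hB hΦ hU hU0 hS hρ₀ hBρ hη hΦ' in
/-- **`im ζ ≤ im ψ(ζ)` on `ℍ`** (boundary Julia lemma, `Complex.im_le_im_of_tendsto_sub_self`).
[folklore] -/
theorem im_le_im_psiStep {ζ : ℂ} (hζ : 0 < ζ.im) : ζ.im ≤ (psiStep Φ Φ' ζ).im :=
  im_le_im_of_tendsto_sub_self (differentiableOn_psiStep hB hΦ hU hU0 hS hρ₀ hBρ hη hΦ')
    (fun _ hζ ↦ (psiStep_spec hB hΦ hU hU0 hS hρ₀ hBρ hη hΦ' hζ).2.2)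
    (tendsto_psiStep_sub_self hB hΦ hU hU0 hS hρ₀ hBρ hη hΦ') hζ

include hB hΦ hU hu hS hρ₀ hBρ hη in
/-- **`ψ(φ⁺(w)) = w`** for `w ∈ ℍ ∩ {|w - w₀| > 2η}`. [folklore] -/
theorem psiStep_phiPlus {w : ℂ} (hw : 0 < w.im) (hwr : 2 * stepSize S u < ‖w - (-hullShift Φ)‖) :
    psiStep Φ Φ' (phiPlus Φ Φ' w) = w := by
  obtain ⟨hz, hEz⟩ := symm_add_hullShift_spec hB hΦ hw
  obtain ⟨halive, hζ⟩ := map_symm_spec hB hΦ hU hu hS hρ₀ hBρ hη hw hwr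
  set z := Φ.symm (w + hullShift Φ) with hzdef
  have hzdom : z ∈ domain U u := (mem_domain_iff U u z).2 ⟨hz.1, halive⟩
  rw [psiStep, phiPlus, hmapT]
  have h1 : hullExt Φ' (map U u z - U u) - hullShift Φ' + U u - U u + hullShift Φ' =
      Φ' (map U u z - U u) := by
    rw [hullExt_of_mem_diff hζ]; ring
  rw [h1, Φ'.symm_apply_apply hζ, sub_add_cancel, loewnerInv_map hU hzdom, hmap, hEz]
  ring

include hB hΦ hU hU0 hu hS hρ₀ hBρ hη hΦ' in
/-- **`0 < im φ⁺(w) ≤ im w`** on `ℍ ∩ {|w - w₀| > 2η}` — the hypothesis of the Schwarz reflection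
package. [folklore] -/
theorem phiPlus_im_pos_le :
    ∀ w ∈ stepDomain Φ (2 * stepSize S u) ∩ {w : ℂ | 0 < w.im},
      0 < (phiPlus Φ Φ' w).im ∧ (phiPlus Φ Φ' w).im ≤ w.im := by
  rintro w ⟨hwr, hw⟩
  have hpos := phiPlus_im_pos hB hΦ hU hU0 hu hS hρ₀ hBρ hη hΦ' hw hwr
  refine ⟨hpos, ?_⟩
  have := im_le_im_psiStep hB hΦ hU hU0 hS hρ₀ hBρ hη hΦ' hpos
  rwa [psiStep_phiPlus hB hΦ hU hu hS hρ₀ hBρ hη hw hwr] at this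


/-! ### Asymptotics: `φ⁺(w) - w → 0`, and the reflected map is hydrodynamically normalized -/

include hU in
/-- The Loewner map preserves `ℍ` as a whole (on the hull it is the identity, its junk value).
[folklore] -/
theorem mapsTo_map_upperHalfPlaneSet : MapsTo (map U u) upperHalfPlaneSet upperHalfPlaneSet := by
  intro z hz
  by_cases h : (u : WithTop ℝ≥0) < swallowingTime U z
  · exact mapsTo_map hU u ((mem_domain_iff U u z).2 ⟨hz, h⟩)
  · rw [map_of_not_lt_swallowingTime h]; exact hz

include hB hΦ hU hU0 hS hρ₀ hBρ hη hΦ' in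
/-- **`φ⁺(w) - w → 0` as `w → ∞` in `ℍ`**: `h⁻¹`, `g`, `h'` are all asymptotic to the identity
(`Φ_B⁻¹(ζ) - ζ → -L`, `g(z) - z → 0`, `g_{B'}(y) - y → 0`). [cite: Lawler2005, §4.6.1 (Φ_t = g*_{s,t} ∘ Φ_s ∘ g_{s,t}⁻¹)] -/
theorem tendsto_phiPlus_sub_self :
    Tendsto (fun w ↦ phiPlus Φ Φ' w - w) (cocompact ℂ ⊓ 𝓟 upperHalfPlaneSet) (𝓝 0) := by
  have hB' := isStarHull_slidHull_step hB hU hU0 hS hρ₀ hBρ hη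
  set F := cocompact ℂ ⊓ 𝓟 upperHalfPlaneSet with hF
  have hLreal : hullShift Φ = ((hullShift Φ).re : ℂ) :=
    Complex.ext rfl (by rw [ofReal_im]; exact hullShift_im hB.isBoundedHull hΦ)
  -- stage 1: `w ↦ w + L`
  set s1 : ℂ → ℂ := fun w ↦ w + hullShift Φ with hs1
  have hT1 : Tendsto s1 F F := by
    have := tendsto_add_real_cocompact_inf (hullShift Φ).re
    refine this.congr fun w ↦ ?_
    rw [hs1]; nth_rewrite 2 [hLreal]; rfl
  -- stage 2: `ζ ↦ z = Φ.symm ζ`, `z - ζ → -L`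
  have hT2sub : Tendsto (fun ζ ↦ Φ.symm ζ - ζ) F (𝓝 (-hullShift Φ)) := hΦ.tendsto_symm_sub_self hB
  have hT2 : Tendsto Φ.symm F F :=
    tendsto_cocompact_inf_of_sub_tendsto hT2sub fun ζ hζ ↦ (Φ.symm_mapsTo hζ).1
  -- stage 3: `z ↦ g z`, `g z - z → 0`
  have hT3sub : Tendsto (fun z ↦ map U u z - z) F (𝓝 0) := tendsto_map_sub_self_holds hU u
  have hT3 : Tendsto (map U u) F F :=
    tendsto_cocompact_inf_of_sub_tendsto hT3sub (mapsTo_map_upperHalfPlaneSet hU)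
  -- stage 4: `y ↦ h'(y)`, `h'(y) - y → 0` (in all directions, a fortiori within `ℍ`)
  have hT4sub : Tendsto (fun y ↦ hmapT Φ' (U u) y - y) F (𝓝 0) := by
    have htr : Tendsto (fun y : ℂ ↦ y - U u) (cocompact ℂ) (cocompact ℂ) := by
      rw [← cobounded_eq_cocompact, ← tendsto_norm_atTop_iff_cobounded]
      have h1 : Tendsto (fun y : ℂ ↦ ‖y‖ + (-‖((U u : ℝ) : ℂ)‖)) (cobounded ℂ) atTop :=
        tendsto_atTop_add_const_right _ _ tendsto_norm_cobounded_atTop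
      refine tendsto_atTop_mono (fun y ↦ ?_) h1
      linarith [norm_sub_norm_le y ((U u : ℝ) : ℂ)]
    have h0 := (tendsto_hullExt_sub_self hB'.isBoundedHull hΦ').comp htr
    have h1 := (h0.sub (tendsto_const_nhds (x := hullShift Φ'))).mono_left (inf_le_left (b := 𝓟 upperHalfPlaneSet))
    rw [sub_self] at h1
    refine h1.congr fun y ↦ ?_
    simp only [comp_apply, hmapT]; ring
  -- combine: `φ⁺ w - w = (h' y - y) + (g z - z) + (z - ζ) + (ζ - w)` with `ζ - w = L`
  have e4 := hT4sub.comp (hT3.comp (hT2.comp hT1))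
  have e3 := hT3sub.comp (hT2.comp hT1)
  have e2 := hT2sub.comp hT1
  have hsum := ((e4.add e3).add e2).add (tendsto_const_nhds (x := hullShift Φ))
  rw [show (0 : ℂ) + 0 + -hullShift Φ + hullShift Φ = 0 by ring] at hsum
  refine hsum.congr fun w ↦ ?_
  simp only [comp_apply, phiPlus, hs1]
  ring

omit hB hΦ hU hU0 hu hS hρ₀ hBρ hη hΦ' in
/-- **Reflection propagates bounds on `f(z) - z` to all directions.** For the Schwarz reflection
`schwarzExt Ω f` of a map with `0 < im f ≤ im` on `Ω ∩ ℍ` (`Ω` open, containing `{‖z‖ > R}`):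
a bound `‖f z - z‖ ≤ ε` on `Ω ∩ ℍ ∩ {‖z‖ > R}` holds for the reflection on all of
`{‖z‖ > R}` (below by conjugation, on the axis by boundary values). [folklore] -/
theorem norm_schwarzExt_sub_self_le {Ω : Set ℂ} {f : ℂ → ℂ} (hΩ : IsOpen Ω)
    (hd : DifferentiableOn ℂ f (Ω ∩ {w | 0 < w.im}))
    (him : ∀ z ∈ Ω ∩ {w : ℂ | 0 < w.im}, 0 < (f z).im ∧ (f z).im ≤ z.im) {R ε : ℝ}
    (hR : ∀ z : ℂ, R < ‖z‖ → z ∈ Ω) (hb : ∀ z ∈ Ω, 0 < z.im → R < ‖z‖ → ‖f z - z‖ ≤ ε)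
    {z : ℂ} (hz : R < ‖z‖) : ‖schwarzExt Ω f z - z‖ ≤ ε := by
  rcases lt_trichotomy z.im 0 with hneg | h0 | hpos
  · rw [Literature.Analysis.Complex.schwarzExt_of_im_neg hneg]
    have hcz : conj z ∈ Ω := hR _ (by rwa [norm_conj])
    have : conj (f (conj z)) - z = conj (f (conj z) - conj z) := by rw [map_sub, conj_conj]
    rw [this, norm_conj]
    exact hb _ hcz (by rw [conj_im]; linarith) (by rwa [norm_conj])
  · have hzr : z = ((z.re : ℝ) : ℂ) := Complex.ext rfl (by simp [h0])
    have hzΩ : z ∈ Ω := hR z hz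
    have hx : ((z.re : ℝ) : ℂ) ∈ Ω := hzr ▸ hzΩ
    have hT := Literature.Analysis.Complex.tendsto_schwarzExt_ofReal hΩ hd him hx
    rw [← hzr] at hT
    haveI : (𝓝[Ω ∩ {w : ℂ | 0 < w.im}] z).NeBot := by
      rw [hzr]; exact Literature.Analysis.Complex.neBot_nhdsWithin_ofReal hΩ hx
    have hT' : Tendsto (fun w ↦ ‖f w - w‖) (𝓝[Ω ∩ {w : ℂ | 0 < w.im}] z)
        (𝓝 ‖schwarzExt Ω f z - z‖) :=
      (continuous_norm.tendsto _).comp (hT.sub ((continuous_id.tendsto z).mono_left nhdsWithin_le_nhds))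
    refine le_of_tendsto hT' ?_
    have hopen : IsOpen {w : ℂ | R < ‖w‖} := isOpen_lt continuous_const continuous_norm
    filter_upwards [mem_nhdsWithin_of_mem_nhds (hopen.mem_nhds hz), self_mem_nhdsWithin] with w hw hw'
    exact hb w hw'.1 hw'.2 hw
  · exact (Literature.Analysis.Complex.schwarzExt_of_im_pos hpos).symm ▸ hb z (hR z hz) hpos hz

include hB hΦ in
/-- The exterior domain in the form used by `IsHydrodynamicAt` (`w₀ = -L` is real). [folklore] -/
theorem stepDomain_eq (r : ℝ) :
    stepDomain Φ r = {w : ℂ | r < ‖w - (((-hullShift Φ).re : ℝ) : ℂ)‖} := by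
  have hLreal : -hullShift Φ = (((-hullShift Φ).re : ℝ) : ℂ) :=
    Complex.ext rfl (by rw [ofReal_im, neg_im, hullShift_im hB.isBoundedHull hΦ, neg_zero])
  ext w
  simp only [stepDomain, mem_setOf_eq]
  rw [← hLreal]

include hB hΦ in
/-- The exterior domain is open and symmetric. [folklore] -/
theorem isOpen_stepDomain (r : ℝ) : IsOpen (stepDomain Φ r) ∧ ∀ z ∈ stepDomain Φ r, conj z ∈ stepDomain Φ r := by
  rw [stepDomain_eq hB hΦ]
  refine ⟨isOpen_lt continuous_const (continuous_id.sub continuous_const).norm, fun z hz ↦ ?_⟩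
  simp only [mem_setOf_eq] at hz ⊢
  rwa [← conj_ofReal, ← map_sub, norm_conj]

include hB hΦ hU hU0 hu hS hρ₀ hBρ hη hΦ' in
/-- **`φ` is hydrodynamically normalized at `w₀ = -L` outside `B(w₀, 2η)`**: the hypothesis
`IsHydrodynamicAt` of Lawler's Prop. 3.46 (`HydrodynamicExpansion`) for the map
`φ = h' ∘ g ∘ h⁻¹` of the conformal image of the increment hull.
[cite: Lawler2005, §4.6.1 (Φ_t = g*_{s,t} ∘ Φ_s ∘ g_{s,t}⁻¹) with Prop. 3.46] -/
theorem isHydrodynamicAt_phiStep :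
    IsHydrodynamicAt (phiStep Φ Φ' (2 * stepSize S u)) ((-hullShift Φ).re) (2 * stepSize S u) := by
  have hη0 := (stepSize_pos hu hS).2
  obtain ⟨hΩo, hΩsymm⟩ := isOpen_stepDomain hB hΦ (2 * stepSize S u)
  have hd := differentiableOn_phiPlus hB hΦ hU hU0 hu hS hρ₀ hBρ hη hΦ'
  have him := phiPlus_im_pos_le hB hΦ hU hU0 hu hS hρ₀ hBρ hη hΦ'
  have heq := stepDomain_eq hB hΦ (2 * stepSize S u)
  refine ⟨by positivity, ?_, ?_, ?_, ?_⟩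
  · rw [← heq]
    exact Literature.Analysis.Complex.differentiableOn_schwarzExt hΩo hΩsymm hd him
  · -- `φ(w) - w → 0` in all directions
    rw [← cobounded_eq_cocompact, Metric.tendsto_nhds]
    intro ε hε
    -- the bound on `ℍ` far out
    have hev := tendsto_phiPlus_sub_self hB hΦ hU hU0 hS hρ₀ hBρ hη hΦ' (closedBall_mem_nhds (0 : ℂ) (half_pos hε))
    rw [← cobounded_eq_cocompact] at hev
    obtain ⟨R₀, -, hR₀⟩ := ((hasBasis_cobounded_compl_closedBall (0 : ℂ)).inf_principal _).eventually_iff.1 hev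
    set R : ℝ := max R₀ (‖-hullShift Φ‖ + 2 * stepSize S u) with hRdef
    have hRΩ : ∀ z : ℂ, R < ‖z‖ → z ∈ stepDomain Φ (2 * stepSize S u) := by
      intro z hz
      show 2 * stepSize S u < ‖z - -hullShift Φ‖
      have h1 : ‖-hullShift Φ‖ + 2 * stepSize S u < ‖z‖ := lt_of_le_of_lt (le_max_right _ _) hz
      linarith [norm_sub_norm_le z (-hullShift Φ)]
    have hb : ∀ z ∈ stepDomain Φ (2 * stepSize S u), 0 < z.im → R < ‖z‖ →
        ‖phiPlus Φ Φ' z - z‖ ≤ ε / 2 := by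
      intro z _ hzim hzR
      have h1 : R₀ < ‖z‖ := lt_of_le_of_lt (le_max_left _ _) hzR
      have := hR₀ ⟨by simp; exact h1, hzim⟩
      simpa [dist_eq_norm] using this
    refine (hasBasis_cobounded_compl_closedBall (0 : ℂ)).eventually_iff.2 ⟨R, trivial, fun z hz ↦ ?_⟩
    have hz' : R < ‖z‖ := by simpa using hz
    rw [dist_eq_norm, sub_zero]
    have := norm_schwarzExt_sub_self_le hΩo hd him hRΩ hb hz'
    exact lt_of_le_of_lt this (by linarith)
  · intro z hz
    have hz' : z ∈ stepDomain Φ (2 * stepSize S u) := by rw [heq]; exact hz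
    exact Literature.Analysis.Complex.schwarzExt_conj hΩo hd him hz'
  · intro z hz hzim
    have hz' : z ∈ stepDomain Φ (2 * stepSize S u) := by rw [heq]; exact hz
    rw [phiStep, Literature.Analysis.Complex.schwarzExt_of_im_pos hzim]
    exact (him z ⟨hz', hzim⟩).2


/-! ### The conjugation identity `φ ∘ h = h' ∘ g` off the small hull -/

include hB hΦ in
/-- **`φ(h(z)) = h'(g(z))` for `z ∈ ℍ ∖ B`** (the definition of `φ⁺`, `h⁻¹(h z) = z`; on `ℍ` the
reflection is `φ⁺` whatever the radius `r`). [cite: Lawler2005, §4.6.1 (Φ_t ∘ g_{s,t} = g*_{s,t} ∘ Φ_s)] -/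
theorem phiStep_hmap_of_im_pos {z : ℂ} (hz : z ∈ upperHalfPlaneSet \ B) (r : ℝ) :
    phiStep Φ Φ' r (hmap Φ z) = hmapT Φ' (U u) (map U u z) := by
  have hw : 0 < (hmap Φ z).im := by
    rw [hmap, sub_im, hullShift_im hB.isBoundedHull hΦ, sub_zero]; exact hullExt_im_pos hz
  rw [phiStep, Literature.Analysis.Complex.schwarzExt_of_im_pos hw, phiPlus]
  have h1 : hmap Φ z + hullShift Φ = Φ z := by rw [hmap, hullExt_of_mem_diff hz]; ring
  rw [h1, Φ.symm_apply_apply hz]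

include hB hU hU0 hS hρ₀ hBρ hη hΦ' in
/-- `h'` commutes with conjugation at points `y` with `y - U_u ∈ Ω_{B'}`. [folklore] -/
theorem hmapT_conj {y : ℂ} (hy : y - U u ∈ symmDomain (slidHull U B u)) :
    hmapT Φ' (U u) (conj y) = conj (hmapT Φ' (U u) y) := by
  have hB' := isStarHull_slidHull_step hB hU hU0 hS hρ₀ hBρ hη
  have hL' : conj (hullShift Φ') = hullShift Φ' := conj_eq_iff_im.2 (hullShift_im hB'.isBoundedHull hΦ')
  rw [hmapT, hmapT, show conj y - (U u : ℂ) = conj (y - U u) by rw [_root_.map_sub, conj_ofReal],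
    hullExt_conj hB'.isBoundedHull hΦ' hy, _root_.map_add, _root_.map_sub, hL', conj_ofReal]

include hB hΦ hU hU0 hu hS hρ₀ hBρ hη hΦ' in
/-- **`φ(h(z)) = h'(g(z))` below the axis** (all three maps commute with conjugation).
[cite: Lawler2005, §4.6.1 (Φ_t ∘ g_{s,t} = g*_{s,t} ∘ Φ_s)] -/
theorem phiStep_hmap_of_im_neg {z : ℂ} (hz : z ∈ symmDomain B) (hzim : z.im < 0)
    (hzr : 2 * stepSize S u < ‖hullExt Φ z‖) :
    phiStep Φ Φ' (2 * stepSize S u) (hmap Φ z) = hmapT Φ' (U u) (map U u z) := by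
  have hcz : conj z ∈ upperHalfPlaneSet \ B := ⟨by show 0 < (conj z).im; rw [conj_im]; linarith, hz.2⟩
  have hEconj : hullExt Φ z = conj (hullExt Φ (conj z)) := by
    have := hullExt_conj hB.isBoundedHull hΦ (conj_mem_symmDomain hz)
    rw [conj_conj] at this; exact this
  have hL : conj (hullShift Φ) = hullShift Φ := conj_eq_iff_im.2 (hullShift_im hB.isBoundedHull hΦ)
  have hwconj : conj (hmap Φ z) = hmap Φ (conj z) := by
    rw [hmap, hmap, _root_.map_sub, hEconj, conj_conj, hL]
  have hw : (hmap Φ z).im < 0 := by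
    rw [hmap, sub_im, hullShift_im hB.isBoundedHull hΦ, sub_zero, hEconj, conj_im, neg_lt_zero]
    exact hullExt_im_pos hcz
  have hczr : 2 * stepSize S u < ‖hullExt Φ (conj z)‖ := by rwa [hEconj, norm_conj] at hzr
  rw [phiStep, Literature.Analysis.Complex.schwarzExt_of_im_neg hw, hwconj]
  have h1 := phiStep_hmap_of_im_pos (Φ' := Φ') hB hΦ hcz (2 * stepSize S u)
  rw [phiStep, Literature.Analysis.Complex.schwarzExt_of_im_pos (by
    rw [hmap, sub_im, hullShift_im hB.isBoundedHull hΦ, sub_zero]; exact hullExt_im_pos hcz)] at h1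
  rw [h1]
  -- `h'(g(z̄)) = conj (h'(g z))`
  obtain ⟨halive, hζ⟩ : (u : WithTop ℝ≥0) < swallowingTime U (conj z) ∧
      map U u (conj z) - U u ∈ upperHalfPlaneSet \ slidHull U B u := by
    have hspec := map_symm_spec (Φ := Φ) hB hΦ hU hu hS hρ₀ hBρ hη (w := hmap Φ (conj z))
      (by rw [hmap, sub_im, hullShift_im hB.isBoundedHull hΦ, sub_zero]; exact hullExt_im_pos hcz)
      (by rw [hmap, show hullExt Φ (conj z) - hullShift Φ - -hullShift Φ = hullExt Φ (conj z) by ring]; exact hczr)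
    have h2 : Φ.symm (hmap Φ (conj z) + hullShift Φ) = conj z := by
      rw [hmap, hullExt_of_mem_diff hcz, sub_add_cancel, Φ.symm_apply_apply hcz]
    rw [h2] at hspec
    exact hspec
  have halive' : (u : WithTop ℝ≥0) < swallowingTime U z := by rwa [swallowingTime_conj] at halive
  rw [map_conj hU halive'] at hζ ⊢
  rw [← hmapT_conj hB hU hU0 hS hρ₀ hBρ hη hΦ', conj_conj]
  have hB' := isStarHull_slidHull_step hB hU hU0 hS hρ₀ hBρ hη
  exact hB'.isBoundedHull.mem_symmDomain_of_mem_diff hζ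


include hU hu hS hBρ hη in
/-- At an alive real point `x ∉ B`, `g(x) - U_u` is a real point of `Ω_{B'}` (off `B'`: `g` is
injective on alive points and `B` is alive). [folklore] -/
theorem map_ofReal_sub_mem_symmDomain {x : ℝ} (hx : (x : ℂ) ∉ B)
    (halive : (u : WithTop ℝ≥0) < swallowingTime U x) :
    map U u x - U u ∈ symmDomain (slidHull U B u) := by
  have hreal : map U u x - U u = (((map U u x - U u).re : ℝ) : ℂ) :=
    Complex.ext rfl (by rw [ofReal_im, sub_im, ofReal_im, map_ofReal_im hU halive, sub_zero])
  rw [hreal, ofReal_mem_symmDomain_iff, ← hreal]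
  rintro ⟨b, hb, hbeq⟩
  have hbalive := (alive_of_mem hU hu hS hBρ hη hb).1
  have heq : map U u b = map U u x := by
    have := congrArg (· + (U u : ℂ)) hbeq
    simpa using this
  have hbx := injOn_map_of_lt_swallowingTime hU u hbalive halive heq
  rw [hbx] at hb
  exact hx hb

include hB hΦ hU hU0 hu hS hρ₀ hBρ hη hΦ' in
/-- **`φ(h(x)) = h'(g(x))` at alive real points `x ∉ B` with `|E_B(x)| > 2η`**: both sides are
continuous at `x` and agree at the points `x + iy`, `y ↓ 0`. [cite: Lawler2005, §4.6.1 (Φ_t ∘ g_{s,t} = g*_{s,t} ∘ Φ_s)] -/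
theorem phiStep_hmap_of_real {x : ℝ} (hx : (x : ℂ) ∉ B)
    (halive : (u : WithTop ℝ≥0) < swallowingTime U x) (hxr : 2 * stepSize S u < ‖hullExt Φ x‖) :
    phiStep Φ Φ' (2 * stepSize S u) (hmap Φ x) = hmapT Φ' (U u) (map U u x) := by
  have hB' := isStarHull_slidHull_step hB hU hU0 hS hρ₀ hBρ hη
  have hxΩ : (x : ℂ) ∈ symmDomain B := ofReal_mem_symmDomain_iff.2 hx
  set f₁ : ℝ → ℂ := fun y ↦ phiStep Φ Φ' (2 * stepSize S u) (hmap Φ ((x : ℂ) + y * I)) with hf₁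
  set f₂ : ℝ → ℂ := fun y ↦ hmapT Φ' (U u) (map U u ((x : ℂ) + y * I)) with hf₂
  have hpath : Tendsto (fun y : ℝ ↦ (x : ℂ) + y * I) (𝓝 0) (𝓝 (x : ℂ)) := by
    have hc : Continuous fun y : ℝ ↦ (x : ℂ) + y * I :=
      continuous_const.add (continuous_ofReal.mul continuous_const)
    simpa using hc.tendsto 0
  -- continuity of both sides at `y = 0`
  have hc₁ : Tendsto f₁ (𝓝 0) (𝓝 (phiStep Φ Φ' (2 * stepSize S u) (hmap Φ x))) := by
    have h1 : ContinuousAt (hmap Φ) x :=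
      ((differentiableAt_hullExt hB.isBoundedHull hΦ hxΩ).sub_const _).continuousAt
    have hwΩ : hmap Φ x ∈ stepDomain Φ (2 * stepSize S u) := by
      show 2 * stepSize S u < ‖hmap Φ x - -hullShift Φ‖
      rw [hmap, show hullExt Φ x - hullShift Φ - -hullShift Φ = hullExt Φ x by ring]; exact hxr
    have h2 : ContinuousAt (phiStep Φ Φ' (2 * stepSize S u)) (hmap Φ x) := by
      have hd := (isHydrodynamicAt_phiStep hB hΦ hU hU0 hu hS hρ₀ hBρ hη hΦ').differentiableOn
      rw [← stepDomain_eq hB hΦ] at hd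
      exact (hd.differentiableAt ((isOpen_stepDomain hB hΦ _).1.mem_nhds hwΩ)).continuousAt
    exact (h2.comp h1).tendsto.comp hpath
  have hc₂ : Tendsto f₂ (𝓝 0) (𝓝 (hmapT Φ' (U u) (map U u x))) := by
    have h1 : ContinuousAt (map U u) x := continuousAt_map hU halive
    have h2 : ContinuousAt (hmapT Φ' (U u)) (map U u x) := by
      have h21 : DifferentiableAt ℂ (hullExt Φ') (map U u x - U u) :=
        differentiableAt_hullExt hB'.isBoundedHull hΦ' (map_ofReal_sub_mem_symmDomain hU hu hS hBρ hη hx halive)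
      have h22 : DifferentiableAt ℂ (fun y : ℂ ↦ hullExt Φ' (y - U u)) (map U u x) :=
        DifferentiableAt.comp (map U u (x : ℂ)) h21 (differentiableAt_id.sub_const _)
      exact ((h22.sub_const _).add_const _).continuousAt
    exact (h2.comp h1).tendsto.comp hpath
  -- agreement for small `y > 0`
  have hev : f₁ =ᶠ[𝓝[>] 0] f₂ := by
    have hopen := isOpen_symmDomain hB.isBoundedHull.isClosed
    have hmem : ∀ᶠ y : ℝ in 𝓝 0, (x : ℂ) + y * I ∈ symmDomain B := hpath (hopen.mem_nhds hxΩ)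
    filter_upwards [mem_nhdsWithin_of_mem_nhds hmem, self_mem_nhdsWithin] with y hy hy'
    have hzU : (x : ℂ) + y * I ∈ upperHalfPlaneSet \ B :=
      ⟨by show 0 < ((x : ℂ) + y * I).im; simpa using hy', hy.1⟩
    exact phiStep_hmap_of_im_pos hB hΦ hzU _
  -- conclude by uniqueness of limits along `y ↓ 0`
  have h1 := hc₁.mono_left (nhdsWithin_le_nhds (s := Ioi (0 : ℝ)))
  have h2 := (hc₂.mono_left (nhdsWithin_le_nhds (s := Ioi (0 : ℝ)))).congr' hev.symm
  exact tendsto_nhds_unique h1 h2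

end Step

end Loewner

end Literature.Probability.RandomPlanarGeometry
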